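import Literature.Geometry.Kaehler.RiemannianHodgeRoughMetric
import Literature.NumberTheory.Transcendental.KaehlerHodgeOfRealProofs
import HarnessLib

/-!
# A rough metric on `ℂ`: `mem_charmonicForms_iff` (and `isSmoothForm_cHodgeStar`) fail as stated

This file settles the status of the named fact
`Literature.NumberTheory.Transcendental.mem_charmonicForms_iff` of
`Literature/NumberTheory/Transcendental/KaehlerHodge.lean` ("`α ∈ charmonicForms o h ↔
IsCHarmonicForm o h α`", Warner, *Foundations of Differentiable Manifolds and Lie Groups*, 6.1 and
Def. 6.7, complexified as in Voisin (2002), §5.1.4) by an explicit, fully computed counterexample,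
and records the same for its sibling `Literature.NumberTheory.Transcendental.isSmoothForm_cHodgeStar`.

## What is refuted, and why

Both facts were sorried *theorems* of a section of `KaehlerHodge.lean` carrying the smooth-structure
instances `[IsManifold 𝓘(ℂ, E) ω M]`, `[IsManifold 𝓘(ℝ, E) ∞ M]`,
`[IsContinuousRiemannianBundle E _]`, `[IsContMDiffRiemannianBundle 𝓘(ℝ, E) ∞ E _]`; the M5 migration
turned them into `def … : Prop`, and a `def` does not pick up unused section instances. As vendored
they bind only `[RiemannianBundle fun x ↦ TangentSpace 𝓘(ℝ, E) x]` — Mathlib's fibrewise inner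
product of *no regularity in the base point* — and quantify over such metrics, whereas in Warner
(4.10, p. 149) and Voisin the metric is `C^∞`. For rough metrics both statements are false, so
neither `mem_charmonicForms_iff_holds` nor `isSmoothForm_cHodgeStar_holds` can ever be proved:

* `not_forall_mem_charmonicForms_iff`, `not_forall_isSmoothForm_cHodgeStar`: the universal closures
  fail (for `E = ℂ`, `n = 2`, degrees `k = 0` resp. `k = 1`);
* `RoughMetricC.not_mem_charmonicForms_iff`, `RoughMetricC.not_isSmoothForm_cHodgeStar`: the
  concrete instance, together with the real statements on the same manifold
  (`RoughMetricC.not_mem_harmonicForms_iff`, `RoughMetricC.not_isSmoothForm_hodgeStar`: the real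
  facts of `RiemannianHodge.lean` fail already for manifolds modelled on a *complex* space).

The positive content for smooth metrics is in the tree: the corrected closed fact
`mem_charmonicForms_iff_of_isContMDiffRiemannianBundle` and its discharge
(`KaehlerHodgeCharmonicProofs.lean`), `ℂ`-linearity of `Δ_d` on smooth forms and the bridge
`mem_charmonicForms_iff_of_contMDiffMetric` (`KaehlerHodgeDecompositionProofs.lean`), and smoothness
of the complex Hodge star (`IsSmoothForm.cHodgeStar`, corrected fact
`isSmoothForm_cHodgeStar_of_isContMDiffRiemannianBundle`, `KaehlerHodgeSmoothProofs.lean`). The sibling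
fact `mem_dolbeaultHarmonicForms_iff` is refuted by a different (shear) metric on `ℂ` in
`KaehlerHodgeRoughMetric.lean` (namespace `ShearMetric`).

## The counterexample (`namespace RoughMetricC`), and why it is rebuilt here

This is the example of `Literature/Geometry/Kaehler/RiemannianHodgeRoughMetric.lean` rebuilt on the
complex line, with the same names in the parallel namespace `RoughMetricC` (so several statements
are textually those of `RoughMetric`, over a different manifold). The real file cannot be *applied*:
the complex facts quantify over manifolds modelled on a complex normed space `E`
(`[NormedSpace ℂ E]`, forms `MForm 𝓘(ℝ, E) M ℂ k`, `MForm.ofReal`, `cHodgeStar`), and the real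
example lives on the model `ℝ × ℝ` with the sup norm, which carries no `NormedSpace ℂ` structure
(complex multiplication is not isometric for the sup norm), while transporting Hodge stars and the
`fderivWithin`-based `mextDeriv` (junk values included) along `ℂ ≃L[ℝ] ℝ × ℝ` would need
naturality statements the tree does not have. Only the one-variable analysis (`RoughMetric.switch`,
differentiable nowhere) is reused. On `M = ℂ` (model
`𝓘(ℝ, ℂ)`, the standard orientation `stdOrientation = Complex.basisOneI.orientation` on every
tangent space) take `g = a dx² + a⁻¹ dy²` (`z = x + iy`) with `a (z) = exp (switch x)`,
`switch t = t` for rational `t`, `switch t = 0` for irrational `t`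
(`Literature.Geometry.Kaehler.RoughMetric.switch`), as a `Bundle.RiemannianMetric` `roughMetric`;
the bundle structure `roughBundle` is a `def` used as a *local* instance only (with priority over
Mathlib's flat instance on the tangent spaces of the inner product space `ℂ`, which plays no role).
Then:

* `a > 0` is differentiable at no point (`not_differentiableAt_fac`), and `a → 1` at the origin;
* `det g = 1`, so the Riemannian volume form is the constant `dx ∧ dy` (`riemannianVolumeForm_eq`)
  and the hypothesis `ho : IsSmoothForm (riemannianVolumeForm o)` of the facts holds;
* `⋆` on `1`-forms is `⋆(β₀ dx + β₁ dy) = (β₀ / a) dy - a β₁ dx` (`hodgeStar_oneForm`, via the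
  proved two-dimensional check `hodgeStar_apply_eq_areaForm_holds`);
* `mextDeriv` is `fderiv`-based, hence takes the junk value `0` wherever a form-valued map is not
  differentiable. For `f₁ = y + x²/2` and `f₂ = -y` the `dx`-coefficient of `⋆ d fᵢ` is `∓a`,
  differentiable nowhere, so `d ⋆ d fᵢ = 0` and `Δ fᵢ = 0`: both are "harmonic", and so are the
  complex `0`-forms `fᵢ ⊗ 1` (`Δ_d (β ⊗ 1) = (Δβ) ⊗ 1`, `cHodgeLaplacian_ofReal_holds`);
* their sum `u = x²/2` has `⋆ d u = (x / a) dy`, differentiable at the origin with derivative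
  `h ↦ (Re h) dy`, so `d ⋆ d u (0) = dx ∧ dy ≠ 0` (`mextDeriv_hodgeStar_mextDeriv_u_apply_zero_ne`)
  and `Δ u (0) = -⋆(dx ∧ dy) ≠ 0` (`⋆` is injective, `hodgeStar_two_ne_zero`, by the proved
  `⋆⋆ = ±1`). Hence `u ⊗ 1 ∈ charmonicForms` (a span) but `¬ IsCHarmonicForm (u ⊗ 1)`;
* likewise `dy` is smooth while `⋆ dy = -a dx` is differentiable nowhere, refuting
  `isSmoothForm_hodgeStar` and (taking real parts of `⋆(dy ⊗ 1) = (⋆dy) ⊗ 1`)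
  `isSmoothForm_cHodgeStar`.

## Design notes

* Everything analytic is done in the fixed model fibre `ℂ` (`flat α` retypes a form as a plain map;
  `mextDeriv_eq_extDeriv` bridges), everything metric in the tangent spaces
  `TangentSpace 𝓘(ℝ, ℂ) p` (local notation `T p`), whose inner product comes from the local
  instance. Casts between the two use `set_option backward.isDefEq.respectTransparency false in`,
  exactly as Mathlib's `riemannianMetricVectorSpace` does. Forms built in the model fibre (`Ω`,
  `DX`, `DY`) are only ever compared with `MForm` values (`riemannianVolumeForm_apply_eq`,
  `mextDeriv_hodgeStar_mextDeriv_u_apply_zero_ne`), never fed directly to the pointwise `hodgeStar`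
  of a tangent space (whose normed structure is the bundle's): the latter cast is definitionally
  fine but too slow for the kernel over `ℂ`, so injectivity of `⋆` is isolated in
  `hodgeStar_two_ne_zero`, stated for tangent-space forms.
* No global instance is registered: `roughBundle` and `Fact (finrank ℝ ℂ = 2)`
  (`Complex.finrank_real_complex_fact`) are local instances of this file.

## References

* F. W. Warner, *Foundations of Differentiable Manifolds and Lie Groups*, GTM 94 (1983), 6.1
  (p. 220: `Δ` is a linear operator on `E^p(M)` — for a smooth metric, 4.10, p. 149) and Def. 6.7
  (p. 222).
* C. Voisin, *Hodge Theory and Complex Algebraic Geometry I* (2002), §5.1.4, Thm. 5.23.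
-/

noncomputable section

open scoped Manifold ContDiff Topology
open Bundle Module Filter Set
open Literature.Geometry.Kaehler
open Literature.Geometry.Kaehler.RoughMetric (switch switch_of_irrational switch_of_not_irrational
  switch_zero tendsto_switch_zero not_differentiableAt_switch)

namespace Literature.NumberTheory.Transcendental

/-! ### Complexification of harmonic forms (general) -/

section OfReal

variable {E : Type*} [NormedAddCommGroup E] [NormedSpace ℂ E] [FiniteDimensional ℂ E]
  {n : ℕ} [Fact (finrank ℝ E = n)]
  {M : Type*} [TopologicalSpace M] [ChartedSpace E M]
  [RiemannianBundle (fun x : M ↦ TangentSpace 𝓘(ℝ, E) x)] {k m : ℕ}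
  (o : (x : M) → Orientation ℝ (TangentSpace 𝓘(ℝ, E) x) (Fin n))

omit [FiniteDimensional ℂ E] [Fact (finrank ℝ E = n)]
  [RiemannianBundle fun x : M ↦ TangentSpace 𝓘(ℝ, E) x] in
/-- Complexification `β ↦ β ⊗ 1` is injective (take real parts); the `↔ 0` form of
`Literature.Geometry.Kaehler.MForm.ofReal_injective` (`ComplexDeRhamRealStructure.lean`), kept
import-light here. [folklore] -/
theorem _root_.Literature.Geometry.Kaehler.MForm.ofReal_eq_zero_iff (β : MForm 𝓘(ℝ, E) M ℝ k) :
    β.ofReal = 0 ↔ β = 0 := by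
  refine ⟨fun h ↦ ?_, fun h ↦ by rw [h, MForm.ofReal_zero]⟩
  rw [← MForm.re_ofReal β, h, ← MForm.ofReal_zero (E := E) (M := M) (k := k), MForm.re_ofReal]

omit [FiniteDimensional ℂ E] [Fact (finrank ℝ E = n)]
  [RiemannianBundle fun x : M ↦ TangentSpace 𝓘(ℝ, E) x] in
/-- A real form is smooth iff its complexification is. [folklore] -/
theorem _root_.Literature.Geometry.Kaehler.MForm.isSmoothForm_ofReal_iff (β : MForm 𝓘(ℝ, E) M ℝ k) :
    IsSmoothForm β.ofReal ↔ IsSmoothForm β :=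
  ⟨fun h ↦ by simpa using h.re, fun h ↦ h.ofReal⟩

/-- **Complexified real forms are `Δ_d`-harmonic iff they are harmonic**, with no hypothesis on
the metric: `Δ_d (β ⊗ 1) = (Δβ) ⊗ 1` (`cHodgeLaplacian_ofReal_holds`) and `β ↦ β ⊗ 1` is injective
and detects smoothness. Voisin (2002), Thm. 5.23 (complex-valued harmonic forms); Warner (1983),
6.1. [folklore] -/
theorem isCHarmonicForm_ofReal_iff (h : k + m = n) (β : MForm 𝓘(ℝ, E) M ℝ k) :
    IsCHarmonicForm o h β.ofReal ↔ IsHarmonicForm o h β := by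
  rw [IsCHarmonicForm, IsHarmonicForm, MForm.isSmoothForm_ofReal_iff, cHodgeLaplacian_ofReal_holds o,
    MForm.ofReal_eq_zero_iff]

end OfReal

namespace RoughMetricC

/-! ### The conformal factor on `ℂ` -/

/-- The conformal factor `a(x + iy) = exp (switch x)`: positive, differentiable nowhere, `→ 1` at
`0`. [folklore] -/
def fac (z : ℂ) : ℝ := Real.exp (switch z.re)

/-- The conformal factor is positive. [folklore] -/
theorem fac_pos (z : ℂ) : 0 < fac z := Real.exp_pos _

/-- The conformal factor is nonzero. [folklore] -/
theorem fac_ne_zero (z : ℂ) : fac z ≠ 0 := (fac_pos z).ne'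

/-- The conformal factor is `1` at the origin. [folklore] -/
@[simp] theorem fac_zero : fac 0 = 1 := by simp [fac]

/-- The conformal factor is differentiable at no point of the plane (restrict to a horizontal line
and take logarithms). [folklore] -/
theorem not_differentiableAt_fac (z : ℂ) : ¬ DifferentiableAt ℝ fac z := by
  intro hd
  set y : ℝ := z.im
  have hline : DifferentiableAt ℝ (fun t : ℝ ↦ (t : ℂ) + (y : ℂ) * Complex.I) z.re :=
    Complex.ofRealCLM.differentiableAt.add_const _
  have hz : (z.re : ℂ) + (y : ℂ) * Complex.I = z := by
    apply Complex.ext <;> simp [y]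
  have h1 : DifferentiableAt ℝ (fac ∘ fun t : ℝ ↦ (t : ℂ) + (y : ℂ) * Complex.I) z.re :=
    (hz ▸ hd).comp z.re hline
  have h2 : DifferentiableAt ℝ (Real.log ∘ (fac ∘ fun t : ℝ ↦ (t : ℂ) + (y : ℂ) * Complex.I))
      z.re :=
    (Real.differentiableAt_log (fac_ne_zero _)).comp z.re h1
  have h3 : Real.log ∘ (fac ∘ fun t : ℝ ↦ (t : ℂ) + (y : ℂ) * Complex.I) = switch := by
    funext t
    simp [fac]
  rw [h3] at h2
  exact not_differentiableAt_switch z.re h2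

/-- The conformal factor tends to `1` at the origin. [folklore] -/
theorem tendsto_fac_zero : Tendsto fac (𝓝 0) (𝓝 1) := by
  have h : Tendsto (fun z : ℂ ↦ switch z.re) (𝓝 0) (𝓝 0) :=
    tendsto_switch_zero.comp (Complex.continuous_re.tendsto' (0 : ℂ) 0 rfl)
  have h2 : fac = Real.exp ∘ fun z : ℂ ↦ switch z.re := rfl
  rw [h2]
  simpa using (Real.continuous_exp.tendsto 0).comp h

/-- The inverse conformal factor tends to `1` at the origin. [folklore] -/
theorem tendsto_fac_inv_zero : Tendsto (fun z ↦ (fac z)⁻¹) (𝓝 0) (𝓝 1) := by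
  simpa using tendsto_fac_zero.inv₀ one_ne_zero

/-! ### The rough metric on `ℂ` -/

attribute [local instance] Complex.finrank_real_complex_fact

local notation "T" => TangentSpace 𝓘(ℝ, ℂ)

/-- The metric `a dx² + a⁻¹ dy²` (`a = fac`) as a continuous bilinear form on `ℂ`. [folklore] -/
def metricInner (p : ℂ) : ℂ →L[ℝ] ℂ →L[ℝ] ℝ :=
  fac p • (ContinuousLinearMap.mul ℝ ℝ).bilinearComp Complex.reCLM Complex.reCLM +
    (fac p)⁻¹ • (ContinuousLinearMap.mul ℝ ℝ).bilinearComp Complex.imCLM Complex.imCLM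

/-- Unfolding of `metricInner`: `g(v, w) = a v₁ w₁ + a⁻¹ v₂ w₂`. [folklore] -/
@[simp]
theorem metricInner_apply (p v w : ℂ) :
    metricInner p v w = fac p * (v.re * w.re) + (fac p)⁻¹ * (v.im * w.im) := by
  simp [metricInner]

set_option backward.isDefEq.respectTransparency false in
/-- The rough Riemannian metric `a dx² + a⁻¹ dy²` on the tangent spaces of `ℂ` (Mathlib's
`Bundle.RiemannianMetric`: no regularity in the base point is required, and none holds). [folklore] -/
def roughMetric : RiemannianMetric (fun x : ℂ ↦ T x) where
  inner p := (metricInner p : ℂ →L[ℝ] ℂ →L[ℝ] ℝ)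
  symm p v w := by
    change metricInner p v w = metricInner p w v
    rw [metricInner_apply, metricInner_apply]
    ring
  pos p v hv := by
    change 0 < metricInner p v v
    rw [metricInner_apply]
    have h1 := fac_pos p
    have h2 : 0 < (fac p)⁻¹ := inv_pos.2 h1
    have : Complex.re v ≠ 0 ∨ Complex.im v ≠ 0 := by
      by_contra h
      simp only [not_or, not_not] at h
      exact hv (Complex.ext h.1 h.2)
    rcases this with h | h
    · have := mul_pos h1 (mul_self_pos.2 h)
      nlinarith [mul_nonneg h2.le (mul_self_nonneg (Complex.im v))]
    · have := mul_pos h2 (mul_self_pos.2 h)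
      nlinarith [mul_nonneg h1.le (mul_self_nonneg (Complex.re v))]
  continuousAt p := by
    change ContinuousAt (fun v : ℂ ↦ metricInner p v v) 0
    exact ((metricInner p).continuous₂.comp (continuous_id.prodMk continuous_id)).continuousAt
  isVonNBounded p := by
    change Bornology.IsVonNBounded ℝ {v : ℂ | metricInner p v v < 1}
    have h1 := fac_pos p
    have h2 : 0 < (fac p)⁻¹ := inv_pos.2 h1
    refine (NormedSpace.isVonNBounded_closedBall ℝ ℂ
      (2 * ((fac p)⁻¹ + fac p))).subset ?_
    intro v hv
    simp only [mem_setOf_eq, metricInner_apply] at hv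
    simp only [Metric.mem_closedBall, dist_zero_right]
    have hv1 : fac p * (v.re * v.re) < 1 := by
      nlinarith [mul_nonneg h2.le (mul_self_nonneg v.im)]
    have hv2 : (fac p)⁻¹ * (v.im * v.im) < 1 := by
      nlinarith [mul_nonneg h1.le (mul_self_nonneg v.re)]
    have hre : |v.re| ≤ (fac p)⁻¹ + fac p := by
      nlinarith [abs_nonneg v.re, abs_mul_abs_self v.re, sq_nonneg (|v.re| - 1),
        mul_inv_cancel₀ h1.ne', sq_abs v.re]
    have him : |v.im| ≤ (fac p)⁻¹ + fac p := by
      nlinarith [abs_nonneg v.im, abs_mul_abs_self v.im, sq_nonneg (|v.im| - 1),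
        mul_inv_cancel₀ h1.ne', sq_abs v.im]
    linarith [Complex.norm_le_abs_re_add_abs_im v]

/-- The rough Riemannian bundle structure on the tangent spaces of `ℂ` (a `def`, used as a *local*
instance in this file only, with priority over Mathlib's flat instance for the inner product space
`ℂ`). [folklore] -/
@[reducible] def roughBundle : RiemannianBundle (fun x : ℂ ↦ T x) := ⟨roughMetric⟩

attribute [local instance 2000] roughBundle

/-- Sanity check: instance resolution finds the rough bundle (not Mathlib's flat one). [folklore] -/
example : (inferInstance : RiemannianBundle (fun x : ℂ ↦ T x)) = roughBundle := rfl

/-- The inner product of the local Riemannian structure is `metricInner` (by construction). [folklore] -/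
theorem inner_eq (p : ℂ) (v w : T p) : inner ℝ v w = metricInner p v w := rfl

/-- The coordinate vector `∂ₓ = 1` in the tangent space at `p`. [folklore] -/
def e₀ (p : ℂ) : T p := (1 : ℂ)

/-- The coordinate vector `∂_y = i` in the tangent space at `p`. [folklore] -/
def e₁ (p : ℂ) : T p := Complex.I

/-- Coordinates of `∂ₓ`. [folklore] -/
@[simp] theorem re_e₀ (p : ℂ) : Complex.re (e₀ p) = 1 := rfl
/-- Coordinates of `∂ₓ`. [folklore] -/
@[simp] theorem im_e₀ (p : ℂ) : Complex.im (e₀ p) = 0 := rfl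
/-- Coordinates of `∂_y`. [folklore] -/
@[simp] theorem re_e₁ (p : ℂ) : Complex.re (e₁ p) = 0 := rfl
/-- Coordinates of `∂_y`. [folklore] -/
@[simp] theorem im_e₁ (p : ℂ) : Complex.im (e₁ p) = 1 := rfl

/-- Coordinate decomposition of a tangent vector. [folklore] -/
theorem eq_smul_e₀_add_smul_e₁ (p : ℂ) (v : T p) :
    v = Complex.re v • e₀ p + Complex.im v • e₁ p := by
  refine Complex.ext ?_ ?_
  · change Complex.re v = Complex.re (Complex.re v • (1 : ℂ) + Complex.im v • Complex.I)
    simp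
  · change Complex.im v = Complex.im (Complex.re v • (1 : ℂ) + Complex.im v • Complex.I)
    simp

/-- The standard basis `(1, i)` of the tangent space at `p` (Mathlib's `Complex.basisOneI`). [folklore] -/
def stdBasis (p : ℂ) : Module.Basis (Fin 2) ℝ (T p) := Complex.basisOneI

/-- The standard basis is `(∂ₓ, ∂_y)`. [folklore] -/
theorem stdBasis_apply (p : ℂ) : ⇑(stdBasis p) = ![e₀ p, e₁ p] :=
  Complex.coe_basisOneI

/-- The standard orientation of `ℂ`, on every tangent space. [folklore] -/
def stdOrientation : (x : ℂ) → Orientation ℝ (T x) (Fin 2) :=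
  fun p ↦ (stdBasis p).orientation

/-- The `g`-orthonormal frame `(a^{-1/2} ∂ₓ, a^{1/2} ∂_y)`. [folklore] -/
def frame (p : ℂ) : Fin 2 → T p :=
  ![(⟨Real.exp (-(switch p.re / 2)), 0⟩ : ℂ), (⟨0, Real.exp (switch p.re / 2)⟩ : ℂ)]

/-- Coordinates of the frame. [folklore] -/
@[simp] theorem re_frame_zero (p : ℂ) :
    Complex.re (frame p 0) = Real.exp (-(switch p.re / 2)) := rfl
/-- Coordinates of the frame. [folklore] -/
@[simp] theorem im_frame_zero (p : ℂ) : Complex.im (frame p 0) = 0 := rfl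
/-- Coordinates of the frame. [folklore] -/
@[simp] theorem re_frame_one (p : ℂ) : Complex.re (frame p 1) = 0 := rfl
/-- Coordinates of the frame. [folklore] -/
@[simp] theorem im_frame_one (p : ℂ) :
    Complex.im (frame p 1) = Real.exp (switch p.re / 2) := rfl

/-- `a · e^{-s/2} · e^{-s/2} = 1` (`a = e^s`). [folklore] -/
theorem fac_mul_exp_mul_exp (p : ℂ) :
    fac p * (Real.exp (-(switch p.re / 2)) * Real.exp (-(switch p.re / 2))) = 1 := by
  rw [fac, ← Real.exp_add, ← Real.exp_add]
  ring_nf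
  exact Real.exp_zero

/-- `a⁻¹ · e^{s/2} · e^{s/2} = 1` (`a = e^s`). [folklore] -/
theorem fac_inv_mul_exp_mul_exp (p : ℂ) :
    (fac p)⁻¹ * (Real.exp (switch p.re / 2) * Real.exp (switch p.re / 2)) = 1 := by
  rw [fac, ← Real.exp_neg, ← Real.exp_add, ← Real.exp_add]
  ring_nf
  exact Real.exp_zero

/-- `(a e^{-s/2}) (a⁻¹ e^{s/2}) = 1` (`a = e^s`). [folklore] -/
theorem fac_mul_exp_mul_fac_inv_mul_exp (p : ℂ) :
    fac p * Real.exp (-(switch p.re / 2)) * ((fac p)⁻¹ * Real.exp (switch p.re / 2)) = 1 := by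
  rw [mul_mul_mul_comm, mul_inv_cancel₀ (fac_ne_zero p), ← Real.exp_add]
  simp

/-- The frame `(a^{-1/2} ∂ₓ, a^{1/2} ∂_y)` is `g`-orthonormal. [folklore] -/
theorem orthonormal_frame (p : ℂ) : Orthonormal ℝ (frame p) := by
  rw [orthonormal_iff_ite]
  intro i j
  fin_cases i <;> fin_cases j
  · rw [inner_eq, metricInner_apply]
    simpa using fac_mul_exp_mul_exp p
  · rw [inner_eq, metricInner_apply]
    simp
  · rw [inner_eq, metricInner_apply]
    simp
  · rw [inner_eq, metricInner_apply]
    simpa using fac_inv_mul_exp_mul_exp p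

/-- The tangent spaces of the complex line are `2`-dimensional over `ℝ`. [folklore] -/
theorem finrank_tangentSpace (p : ℂ) : finrank ℝ (T p) = 2 := Complex.finrank_real_complex

/-- The frame as an orthonormal basis of the tangent space at `p`. [folklore] -/
def onb (p : ℂ) : OrthonormalBasis (Fin 2) ℝ (T p) :=
  (basisOfOrthonormalOfCardEqFinrank (orthonormal_frame p)
    (by rw [finrank_tangentSpace]; simp)).toOrthonormalBasis
    (by simpa using orthonormal_frame p)

/-- The orthonormal basis is the frame. [folklore] -/
@[simp]
theorem onb_apply (p : ℂ) : ⇑(onb p) = frame p := by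
  simp [onb]

/-- `g(a^{-1/2} ∂ₓ, v) = a · a^{-1/2} · v₁`. [folklore] -/
theorem inner_frame_zero (p : ℂ) (v : T p) :
    inner ℝ (frame p 0) v = fac p * Real.exp (-(switch p.re / 2)) * Complex.re v := by
  rw [inner_eq, metricInner_apply, re_frame_zero, im_frame_zero]
  ring

/-- `g(a^{1/2} ∂_y, v) = a⁻¹ · a^{1/2} · v₂`. [folklore] -/
theorem inner_frame_one (p : ℂ) (v : T p) :
    inner ℝ (frame p 1) v = (fac p)⁻¹ * Real.exp (switch p.re / 2) * Complex.im v := by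
  rw [inner_eq, metricInner_apply, re_frame_one, im_frame_one]
  ring

/-- The determinant of the orthonormal frame is the standard determinant `v₁ w₂ - v₂ w₁`
(the frame is obtained from `(∂ₓ, ∂_y)` by a diagonal matrix of determinant `1`). [folklore] -/
theorem det_onb (p : ℂ) (v w : T p) :
    (onb p).toBasis.det ![v, w] =
      Complex.re v * Complex.im w - Complex.im v * Complex.re w := by
  rw [Module.Basis.det_apply, Matrix.det_fin_two]
  simp only [Module.Basis.toMatrix_apply, OrthonormalBasis.coe_toBasis_repr_apply,
    OrthonormalBasis.repr_apply_apply, onb_apply, inner_frame_zero, inner_frame_one]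
  simp
  linear_combination (Complex.re v * Complex.im w - Complex.im v * Complex.re w) *
    fac_mul_exp_mul_fac_inv_mul_exp p

/-- The frame is positively oriented for the standard orientation. [folklore] -/
theorem orientation_onb (p : ℂ) : (onb p).toBasis.orientation = stdOrientation p := by
  rw [stdOrientation, Module.Basis.orientation_eq_iff_det_pos, stdBasis_apply, det_onb]
  simp

/-- The Riemannian volume form of the rough metric is the standard determinant at every point. [folklore] -/
theorem volumeForm_apply (p : ℂ) (v w : T p) :
    (stdOrientation p).volumeForm ![v, w] =
      Complex.re v * Complex.im w - Complex.im v * Complex.re w := by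
  rw [Orientation.volumeForm_robust (stdOrientation p) (onb p) (orientation_onb p), det_onb]

/-! ### The Hodge star of the rough metric on `1`-forms -/

/-- The Riesz representative of a covector `ℓ` for the rough metric: `(ℓ(∂ₓ)/a, a ℓ(∂_y))`. [folklore] -/
def riesz (p : ℂ) (ℓ : T p →L[ℝ] ℝ) : T p :=
  (⟨(fac p)⁻¹ * ℓ (e₀ p), fac p * ℓ (e₁ p)⟩ : ℂ)

/-- `riesz p ℓ` represents `ℓ`: `g(riesz ℓ, ·) = ℓ`. [folklore] -/
theorem innerSL_riesz (p : ℂ) (ℓ : T p →L[ℝ] ℝ) : innerSL ℝ (riesz p ℓ) = ℓ := by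
  ext v
  rw [innerSL_apply_apply, inner_eq, metricInner_apply]
  conv_rhs => rw [eq_smul_e₀_add_smul_e₁ p v]
  simp only [riesz, map_add, map_smul, smul_eq_mul]
  field_simp [fac_ne_zero p]

/-- The Hodge star of the rough metric on `1`-forms: `⋆(β₀ dx + β₁ dy) = (β₀ / a) dy - a β₁ dx`. [folklore] -/
theorem hodgeStar_ofSubsingleton_apply (p : ℂ) (h : 1 + 1 = 2) (ℓ : T p →L[ℝ] ℝ) (w : T p) :
    hodgeStar (stdOrientation p) h (ContinuousAlternatingMap.ofSubsingleton ℝ (T p) ℝ (0 : Fin 1) ℓ)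
        ![w] =
      (fac p)⁻¹ * ℓ (e₀ p) * Complex.im w - fac p * ℓ (e₁ p) * Complex.re w := by
  rw [← innerSL_riesz p ℓ, hodgeStar_apply_eq_areaForm_holds (stdOrientation p) h,
    Orientation.areaForm_to_volumeForm, volumeForm_apply, innerSL_riesz]
  simp [riesz]

/-! ### Forms on the flat complex line -/

/-- In the flat case the chart representative of a form is the form itself. [folklore] -/
theorem inChart_eq_self {F : Type*} [NormedAddCommGroup F] [NormedSpace ℝ F] {k : ℕ}
    (α : MForm 𝓘(ℝ, ℂ) ℂ F k) (x : ℂ) : α.inChart x = α := by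
  funext y
  ext v
  simp [MForm.inChart_apply]
  rfl

/-- A form on the flat complex line as a plain map into the fixed model fibre (the identity,
retyped: `TangentSpace 𝓘(ℝ, ℂ) x` is `ℂ` by definition). [folklore] -/
def flat {k : ℕ} (α : MForm 𝓘(ℝ, ℂ) ℂ ℝ k) : ℂ → ℂ [⋀^Fin k]→L[ℝ] ℝ := α

/-- In the flat case, chart-wise smoothness is plain smoothness. [folklore] -/
theorem isSmoothForm_of_contDiff {k : ℕ} {α : MForm 𝓘(ℝ, ℂ) ℂ ℝ k}
    (hα : ContDiff ℝ ∞ (flat α)) : IsSmoothForm α := by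
  intro x
  rw [inChart_eq_self]
  exact hα.contDiffAt.contDiffWithinAt

/-- In the flat case, a chart-wise smooth form is differentiable as a plain map. [folklore] -/
theorem differentiableAt_of_isSmoothForm {k : ℕ} {β : MForm 𝓘(ℝ, ℂ) ℂ ℝ k}
    (hβ : IsSmoothForm β) (p : ℂ) : DifferentiableAt ℝ (flat β) p := by
  have h := hβ p
  rw [inChart_eq_self] at h
  simp only [modelWithCornersSelf_coe, Set.range_id, extChartAt_self_apply, id_eq,
    contDiffWithinAt_univ] at h
  exact h.differentiableAt (by simp)

/-- The `0`-form attached to a function. [folklore] -/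
def zeroForm (f : ℂ → ℝ) : MForm 𝓘(ℝ, ℂ) ℂ ℝ 0 :=
  fun x ↦ ContinuousAlternatingMap.constOfIsEmpty ℝ (T x) (Fin 0) (f x)

/-- `zeroForm` is additive. [folklore] -/
theorem zeroForm_add (f g : ℂ → ℝ) : zeroForm (f + g) = zeroForm f + zeroForm g := by
  funext x
  ext v
  simp [zeroForm]

/-- The `0`-form of a smooth function is a smooth form. [folklore] -/
theorem isSmoothForm_zeroForm {f : ℂ → ℝ} (hf : ContDiff ℝ ∞ f) : IsSmoothForm (zeroForm f) :=
  isSmoothForm_of_contDiff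
    ((ContinuousAlternatingMap.constOfIsEmptyLIE ℝ ℂ ℝ (Fin 0)).contDiff.comp hf)

/-- The `1`-form attached to a family of covectors. [folklore] -/
def oneForm (ℓ : ℂ → ℂ →L[ℝ] ℝ) : MForm 𝓘(ℝ, ℂ) ℂ ℝ 1 :=
  fun x ↦ ContinuousAlternatingMap.ofSubsingleton ℝ (T x) ℝ (0 : Fin 1) (ℓ x)

/-- `d` of the `0`-form of `f` is the `1`-form of `fderiv ℝ f` (Mathlib's
`extDeriv_constOfIsEmpty`, through `mextDeriv_eq_extDeriv`). [folklore] -/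
theorem mextDeriv_zeroForm (f : ℂ → ℝ) : mextDeriv (zeroForm f) = oneForm (fderiv ℝ f) := by
  funext x
  rw [mextDeriv_eq_extDeriv]
  exact extDeriv_constOfIsEmpty f x

/-- `dx` as a constant `1`-form (in the fixed model space). [folklore] -/
def DX : ℂ [⋀^Fin 1]→L[ℝ] ℝ :=
  ContinuousAlternatingMap.ofSubsingleton ℝ ℂ ℝ (0 : Fin 1) Complex.reCLM

/-- `dy` as a constant `1`-form (in the fixed model space). [folklore] -/
def DY : ℂ [⋀^Fin 1]→L[ℝ] ℝ :=
  ContinuousAlternatingMap.ofSubsingleton ℝ ℂ ℝ (0 : Fin 1) Complex.imCLM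

/-- `dx (v) = Re v`. [folklore] -/
@[simp] theorem DX_apply (v : Fin 1 → ℂ) : DX v = (v 0).re := rfl
/-- `dy (v) = Im v`. [folklore] -/
@[simp] theorem DY_apply (v : Fin 1 → ℂ) : DY v = (v 0).im := rfl

/-- The Hodge star of the rough metric on the `1`-form attached to `ℓ`, as an explicit form:
`⋆(ℓ₀ dx + ℓ₁ dy) = (ℓ₀ / a) dy - a ℓ₁ dx`. [folklore] -/
theorem hodgeStar_oneForm (h : 1 + 1 = 2) (ℓ : ℂ → ℂ →L[ℝ] ℝ) :
    MForm.hodgeStar stdOrientation h (oneForm ℓ) = fun p ↦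
      (((fac p)⁻¹ * ℓ p 1) • DY - (fac p * ℓ p Complex.I) • DX : ℂ [⋀^Fin 1]→L[ℝ] ℝ) := by
  funext p
  ext w
  have hw : w = ![w 0] := by
    funext i
    fin_cases i
    rfl
  rw [MForm.hodgeStar_apply, hw, oneForm, hodgeStar_ofSubsingleton_apply]
  change _ = (fac p)⁻¹ * ℓ p 1 * Complex.im (w 0) - fac p * ℓ p Complex.I * Complex.re (w 0)
  rfl

/-- A form-valued map whose `dx`-coefficient along `∂ₓ` is a nonzero multiple of the conformal
factor is differentiable nowhere. [folklore] -/
theorem not_differentiableAt_of_apply_eq {S : ℂ → ℂ [⋀^Fin 1]→L[ℝ] ℝ} {c : ℝ}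
    (hc : c ≠ 0) (hS : ∀ q, S q ![(1 : ℂ)] = c * fac q) (p : ℂ) :
    ¬ DifferentiableAt ℝ S p := by
  intro hd
  have h1 : DifferentiableAt ℝ
      (⇑(ContinuousAlternatingMap.apply ℝ ℂ ℝ ![(1 : ℂ)]) ∘ S) p :=
    (ContinuousLinearMap.differentiableAt _).comp p hd
  have h2 : ⇑(ContinuousAlternatingMap.apply ℝ ℂ ℝ ![(1 : ℂ)]) ∘ S = fun q ↦ c * fac q := by
    funext q
    exact hS q
  rw [h2] at h1
  have h3 : DifferentiableAt ℝ (fun q ↦ c⁻¹ * (c * fac q)) p := h1.const_mul c⁻¹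
  simp only [inv_mul_cancel_left₀ hc] at h3
  exact not_differentiableAt_fac p h3

/-- Junk values: the manifold exterior derivative of a nowhere-differentiable `1`-form-valued map
vanishes identically (`fderiv` is `0` at points of non-differentiability). [folklore] -/
theorem mextDeriv_eq_zero_of_forall_not_differentiableAt {β : MForm 𝓘(ℝ, ℂ) ℂ ℝ 1}
    (hβ : ∀ p, ¬ DifferentiableAt ℝ (flat β) p) : mextDeriv β = 0 := by
  funext p
  rw [mextDeriv_eq_extDeriv, Pi.zero_apply]
  change ContinuousAlternatingMap.alternatizeUncurryFin (fderiv ℝ (flat β) p) = 0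
  rw [fderiv_zero_of_not_differentiableAt (hβ p)]
  exact map_zero _

/-! ### The three functions -/

/-- `f₁ (x + iy) = y + x² / 2`. [folklore] -/
def f₁ (p : ℂ) : ℝ := p.im + p.re ^ 2 / 2

/-- `f₂ (x + iy) = -y`. [folklore] -/
def f₂ (p : ℂ) : ℝ := -p.im

/-- `u (x + iy) = x² / 2 = f₁ + f₂`. [folklore] -/
def u (p : ℂ) : ℝ := p.re ^ 2 / 2

/-- `f₁ + f₂ = u`. [folklore] -/
theorem f₁_add_f₂ : f₁ + f₂ = u := by
  funext p
  simp [f₁, f₂, u]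

/-- `Re` is smooth (as a real function on `ℂ`). [folklore] -/
theorem contDiff_re : ContDiff ℝ ∞ (fun p : ℂ ↦ p.re) := Complex.reCLM.contDiff

/-- `Im` is smooth (as a real function on `ℂ`). [folklore] -/
theorem contDiff_im : ContDiff ℝ ∞ (fun p : ℂ ↦ p.im) := Complex.imCLM.contDiff

/-- `u` is smooth. [folklore] -/
theorem contDiff_u : ContDiff ℝ ∞ u := (contDiff_re.pow 2).div_const 2

/-- `f₁` is smooth. [folklore] -/
theorem contDiff_f₁ : ContDiff ℝ ∞ f₁ := contDiff_im.add contDiff_u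

/-- `f₂` is smooth. [folklore] -/
theorem contDiff_f₂ : ContDiff ℝ ∞ f₂ := contDiff_im.neg

/-- `D Re = dx`. [folklore] -/
theorem hasFDerivAt_re (p : ℂ) : HasFDerivAt (fun q : ℂ ↦ q.re) Complex.reCLM p :=
  Complex.reCLM.hasFDerivAt

/-- `D Im = dy`. [folklore] -/
theorem hasFDerivAt_im (p : ℂ) : HasFDerivAt (fun q : ℂ ↦ q.im) Complex.imCLM p :=
  Complex.imCLM.hasFDerivAt

/-- `Du (x + iy) = x dx`. [folklore] -/
theorem hasFDerivAt_u (p : ℂ) : HasFDerivAt u (p.re • Complex.reCLM) p := by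
  have h : HasDerivAt (fun t : ℝ ↦ t ^ 2 / 2) (((2 : ℕ) : ℝ) * p.re ^ (2 - 1) / 2) p.re :=
    (hasDerivAt_pow 2 p.re).div_const 2
  have h2 : ((2 : ℕ) : ℝ) * p.re ^ (2 - 1) / 2 = p.re := by norm_num
  rw [h2] at h
  exact h.comp_hasFDerivAt p (hasFDerivAt_re p)

/-- `Du = x dx`. [folklore] -/
theorem fderiv_u : fderiv ℝ u = fun p ↦ p.re • Complex.reCLM :=
  funext fun p ↦ (hasFDerivAt_u p).fderiv

/-- `Df₁ = dy + x dx`. [folklore] -/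
theorem fderiv_f₁ :
    fderiv ℝ f₁ = fun p ↦ Complex.imCLM + p.re • Complex.reCLM :=
  funext fun p ↦ ((hasFDerivAt_im p).add (hasFDerivAt_u p)).fderiv

/-- `Df₂ = -dy`. [folklore] -/
theorem fderiv_f₂ : fderiv ℝ f₂ = fun _ ↦ -Complex.imCLM :=
  funext fun p ↦ (hasFDerivAt_im p).neg.fderiv

/-! ### `⋆ d` of the three functions -/

/-- `⋆ d f₁ = (x / a) dy - a dx`. [folklore] -/
theorem hodgeStar_mextDeriv_f₁ (h : 0 + 1 + 1 = 2) :
    MForm.hodgeStar stdOrientation h (mextDeriv (zeroForm f₁)) = fun p ↦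
      (((fac p)⁻¹ * p.re) • DY - fac p • DX : ℂ [⋀^Fin 1]→L[ℝ] ℝ) := by
  rw [mextDeriv_zeroForm, fderiv_f₁]
  refine (hodgeStar_oneForm h _).trans ?_
  funext p
  simp

/-- `⋆ d f₂ = a dx`. [folklore] -/
theorem hodgeStar_mextDeriv_f₂ (h : 0 + 1 + 1 = 2) :
    MForm.hodgeStar stdOrientation h (mextDeriv (zeroForm f₂)) = fun p ↦
      (fac p • DX : ℂ [⋀^Fin 1]→L[ℝ] ℝ) := by
  rw [mextDeriv_zeroForm, fderiv_f₂]
  refine (hodgeStar_oneForm h _).trans ?_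
  funext p
  simp only [neg_apply, Complex.imCLM_apply, Complex.one_im, Complex.I_im,
    mul_neg, mul_zero, neg_zero, zero_smul, mul_one, zero_sub]
  module

/-- `⋆ d u = (x / a) dy`. [folklore] -/
theorem hodgeStar_mextDeriv_u (h : 0 + 1 + 1 = 2) :
    MForm.hodgeStar stdOrientation h (mextDeriv (zeroForm u)) = fun p ↦
      (((fac p)⁻¹ * p.re) • DY : ℂ [⋀^Fin 1]→L[ℝ] ℝ) := by
  rw [mextDeriv_zeroForm, fderiv_u]
  refine (hodgeStar_oneForm h _).trans ?_
  funext p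
  simp

/-- `⋆ d f₁` is differentiable nowhere (its `dx`-coefficient is `-a`). [folklore] -/
theorem not_differentiableAt_hodgeStar_mextDeriv_f₁ (h : 0 + 1 + 1 = 2) (p : ℂ) :
    ¬ DifferentiableAt ℝ (flat (MForm.hodgeStar stdOrientation h (mextDeriv (zeroForm f₁)))) p := by
  rw [hodgeStar_mextDeriv_f₁]
  unfold flat
  refine not_differentiableAt_of_apply_eq (c := -1) (by norm_num) (fun q ↦ ?_) p
  simp

/-- `⋆ d f₂` is differentiable nowhere (its `dx`-coefficient is `a`). [folklore] -/
theorem not_differentiableAt_hodgeStar_mextDeriv_f₂ (h : 0 + 1 + 1 = 2) (p : ℂ) :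
    ¬ DifferentiableAt ℝ (flat (MForm.hodgeStar stdOrientation h (mextDeriv (zeroForm f₂)))) p := by
  rw [hodgeStar_mextDeriv_f₂]
  unfold flat
  refine not_differentiableAt_of_apply_eq (c := 1) (by norm_num) (fun q ↦ ?_) p
  simp

/-- The coefficient `x / a` of `⋆ d u` is differentiable at the origin, with derivative `dx`
(because `1 / a → 1` there). [folklore] -/
theorem hasFDerivAt_fac_inv_mul_re :
    HasFDerivAt (fun p : ℂ ↦ (fac p)⁻¹ * p.re) Complex.reCLM 0 := by
  rw [hasFDerivAt_iff_isLittleO_nhds_zero]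
  have hg : (fun p : ℂ ↦ (fac p)⁻¹ - 1) =o[𝓝 0] (fun _ ↦ (1 : ℝ)) := by
    rw [Asymptotics.isLittleO_one_iff]
    simpa using tendsto_fac_inv_zero.sub_const 1
  have hk : (fun p : ℂ ↦ p.re) =O[𝓝 (0 : ℂ)] (fun p ↦ p) :=
    Asymptotics.IsBigO.of_bound 1 (Eventually.of_forall fun p ↦ by
      simpa using Complex.abs_re_le_norm p)
  have key : (fun p : ℂ ↦ ((fac p)⁻¹ - 1) * p.re) =o[𝓝 (0 : ℂ)] (fun p ↦ p) :=
    ((hg.mul_isBigO hk.norm_right).congr_right (fun p ↦ one_mul _)).of_norm_right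
  refine key.congr' (Eventually.of_forall fun p ↦ ?_) EventuallyEq.rfl
  simp only [zero_add, fac_zero, Complex.zero_re, Complex.reCLM_apply]
  ring

/-! ### The `2`-form `dx ∧ dy` -/

/-- `dx ∧ dy` (in the fixed model space), written in the form in which it arises below as
`d ⋆ d u (0)`: the alternatisation of `h ↦ (Re h) • dy`. [folklore] -/
def Ω : ℂ [⋀^Fin (1 + 1)]→L[ℝ] ℝ :=
  ContinuousAlternatingMap.alternatizeUncurryFin (Complex.reCLM.smulRight DY)

/-- `Ω = dx ∧ dy`: `Ω (v, w) = v₁ w₂ - v₂ w₁`. [folklore] -/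
theorem Ω_apply (v : Fin 2 → ℂ) : Ω v = (v 0).re * (v 1).im - (v 0).im * (v 1).re := by
  simp [Ω, ContinuousAlternatingMap.alternatizeUncurryFin_apply, Fin.sum_univ_two, Fin.removeNth]
  ring

/-- `dx ∧ dy ≠ 0`. [folklore] -/
theorem Ω_ne_zero : Ω ≠ 0 := fun h ↦ by
  simpa [h] using Ω_apply ![(1 : ℂ), Complex.I]

/-! ### The volume form is the constant `dx ∧ dy`, hence smooth -/

/-- The Riemannian volume form of the rough metric is the standard determinant (tuple form). [folklore] -/
theorem volumeForm_apply' (p : ℂ) (v : Fin 2 → T p) :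
    (stdOrientation p).volumeForm v =
      Complex.re (v 0) * Complex.im (v 1) - Complex.im (v 0) * Complex.re (v 1) := by
  have hv : v = ![v 0, v 1] := by
    funext i
    fin_cases i <;> rfl
  rw [hv, volumeForm_apply]
  rfl

/-- The Riemannian volume form of the rough metric is `dx ∧ dy` at every point (applied). [folklore] -/
theorem volumeFormL_apply_eq (p : ℂ) (v : Fin 2 → T p) :
    (stdOrientation p).volumeFormL v = Ω v := by
  rw [Orientation.volumeFormL_apply, volumeForm_apply' p v, Ω_apply]

set_option backward.isDefEq.respectTransparency false in
/-- The Riemannian volume form of the rough metric is `dx ∧ dy` at every point (as an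
`MForm` value). [folklore] -/
theorem riemannianVolumeForm_apply_eq (p : ℂ) : riemannianVolumeForm stdOrientation p = Ω :=
  ContinuousAlternatingMap.ext fun v ↦ volumeFormL_apply_eq p v

set_option backward.isDefEq.respectTransparency false in
/-- The Riemannian volume form of the rough metric is the constant form `dx ∧ dy`. [folklore] -/
theorem riemannianVolumeForm_eq : riemannianVolumeForm stdOrientation = fun _ ↦ Ω :=
  funext fun p ↦ riemannianVolumeForm_apply_eq p

set_option backward.isDefEq.respectTransparency false in
/-- The hypothesis `ho` of the facts holds: the Riemannian volume form of the rough metric is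
smooth (it is the constant form `dx ∧ dy`). [folklore] -/
theorem isSmoothForm_riemannianVolumeForm : IsSmoothForm (riemannianVolumeForm stdOrientation) := by
  rw [riemannianVolumeForm_eq]
  exact isSmoothForm_of_contDiff contDiff_const

set_option backward.isDefEq.respectTransparency false in
/-- The pointwise Hodge star is injective on `2`-forms at the origin (`⋆⋆ = 1` there). [folklore] -/
theorem hodgeStar_two_ne_zero (h : 1 + 1 + 0 = 2) {β : T (0 : ℂ) [⋀^Fin (1 + 1)]→L[ℝ] ℝ}
    (hβ : β ≠ 0) : hodgeStar (stdOrientation 0) h β ≠ 0 := by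
  intro h0
  have key := hodgeStar_hodgeStar_holds (stdOrientation 0) h (show 0 + (1 + 1) = 2 by norm_num)
    β
  have h1 := congrArg (hodgeStar (stdOrientation 0) (show 0 + (1 + 1) = 2 by norm_num)) h0
  rw [key, map_zero] at h1
  simp at h1
  exact hβ h1

set_option backward.isDefEq.respectTransparency false in
/-- `d ⋆ d u (0) = dx ∧ dy ≠ 0`: `⋆ d u = (x / a) dy` is differentiable at the origin with
derivative `h ↦ (Re h) dy`, whose alternatisation is `Ω = dx ∧ dy`. [folklore] -/
theorem mextDeriv_hodgeStar_mextDeriv_u_apply_zero_ne (h : 0 + 1 + 1 = 2) :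
    mextDeriv (MForm.hodgeStar stdOrientation h (mextDeriv (zeroForm u))) 0 ≠ 0 := by
  rw [hodgeStar_mextDeriv_u, mextDeriv_eq_extDeriv, extDeriv,
    (hasFDerivAt_fac_inv_mul_re.smul_const DY).fderiv]
  exact Ω_ne_zero

/-! ### The Laplacians of the three functions -/

/-- Junk harmonicity: if `⋆ d f` is differentiable nowhere then `Δ f = -⋆ d ⋆ d f = 0`. [folklore] -/
theorem hodgeLaplacian_zeroForm_eq_zero {f : ℂ → ℝ} (h : 0 + 2 = 2)
    (hf : ∀ (h' : 0 + 1 + 1 = 2) (p : ℂ),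
      ¬ DifferentiableAt ℝ (flat (MForm.hodgeStar stdOrientation h' (mextDeriv (zeroForm f)))) p) :
    hodgeLaplacian stdOrientation 0 2 h (zeroForm f) = 0 := by
  simp only [hodgeLaplacian, mcoderiv]
  rw [mextDeriv_eq_zero_of_forall_not_differentiableAt (hf _), map_zero, smul_zero]

/-- `f₁ = y + x²/2` is harmonic for the rough metric (smooth, and `Δ f₁ = 0` by junk values). [folklore] -/
theorem isHarmonicForm_zeroForm_f₁ (h : 0 + 2 = 2) : IsHarmonicForm stdOrientation h (zeroForm f₁) :=
  ⟨isSmoothForm_zeroForm contDiff_f₁,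
    hodgeLaplacian_zeroForm_eq_zero h not_differentiableAt_hodgeStar_mextDeriv_f₁⟩

/-- `f₂ = -y` is harmonic for the rough metric (smooth, and `Δ f₂ = 0` by junk values). [folklore] -/
theorem isHarmonicForm_zeroForm_f₂ (h : 0 + 2 = 2) : IsHarmonicForm stdOrientation h (zeroForm f₂) :=
  ⟨isSmoothForm_zeroForm contDiff_f₂,
    hodgeLaplacian_zeroForm_eq_zero h not_differentiableAt_hodgeStar_mextDeriv_f₂⟩

/-- `x² / 2 = f₁ + f₂` lies in the span of the harmonic forms. [folklore] -/
theorem zeroForm_u_mem_harmonicForms (h : 0 + 2 = 2) :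
    zeroForm u ∈ harmonicForms stdOrientation h := by
  rw [← f₁_add_f₂, zeroForm_add]
  exact add_mem (subset_harmonicForms _ h (isHarmonicForm_zeroForm_f₁ h))
    (subset_harmonicForms _ h (isHarmonicForm_zeroForm_f₂ h))

set_option backward.isDefEq.respectTransparency false in
/-- `Δ (x² / 2) ≠ 0` at the origin: `Δ u (0) = -⋆ (d ⋆ d u (0))` with `d ⋆ d u (0) = dx ∧ dy ≠ 0`
and `⋆` injective. [folklore] -/
theorem hodgeLaplacian_zeroForm_u_apply_zero_ne (h : 0 + 2 = 2) :
    hodgeLaplacian stdOrientation 0 2 h (zeroForm u) 0 ≠ 0 := by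
  simp only [hodgeLaplacian, mcoderiv]
  rw [Pi.smul_apply, MForm.hodgeStar_apply, smul_ne_zero_iff]
  exact ⟨by norm_num, hodgeStar_two_ne_zero _ (mextDeriv_hodgeStar_mextDeriv_u_apply_zero_ne _)⟩

/-- `u = x²/2` is not harmonic for the rough metric. [folklore] -/
theorem not_isHarmonicForm_zeroForm_u (h : 0 + 2 = 2) :
    ¬ IsHarmonicForm stdOrientation h (zeroForm u) := fun hu ↦
  hodgeLaplacian_zeroForm_u_apply_zero_ne h (by rw [hu.2]; rfl)

/-! ### Conclusions, real coefficients -/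

/-- **The rough metric on `ℂ` violates `mem_harmonicForms_iff`** (degree `0`, dimension `2`): the
smooth function `x² / 2` lies in `harmonicForms` (it is the sum of the harmonic `y + x² / 2` and
`-y`) but is not harmonic. [folklore] -/
theorem not_mem_harmonicForms_iff :
    ¬ mem_harmonicForms_iff (k := 0) (m := 2) stdOrientation := fun H ↦
  not_isHarmonicForm_zeroForm_u _ ((H isSmoothForm_riemannianVolumeForm (by norm_num) _).1
    (zeroForm_u_mem_harmonicForms _))

/-- `dy` is a smooth `1`-form. [folklore] -/
theorem isSmoothForm_oneForm_imCLM : IsSmoothForm (oneForm fun _ ↦ Complex.imCLM) := by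
  refine isSmoothForm_of_contDiff ?_
  have : flat (oneForm fun _ ↦ Complex.imCLM) = fun _ ↦ DY := rfl
  rw [this]
  exact contDiff_const

/-- `⋆ dy = -a dx` is not smooth (it is differentiable nowhere). [folklore] -/
theorem not_isSmoothForm_hodgeStar_oneForm_imCLM (h : 1 + 1 = 2) :
    ¬ IsSmoothForm (MForm.hodgeStar stdOrientation h (oneForm fun _ ↦ Complex.imCLM)) := by
  intro H
  have hd := differentiableAt_of_isSmoothForm H 0
  rw [hodgeStar_oneForm] at hd
  unfold flat at hd
  refine not_differentiableAt_of_apply_eq (c := -1) (by norm_num) (fun q ↦ ?_) 0 hd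
  simp

/-- **The rough metric on `ℂ` violates `isSmoothForm_hodgeStar`** (degree `1`, dimension `2`):
`dy` is smooth but `⋆ dy = -a dx` is differentiable nowhere. [folklore] -/
theorem not_isSmoothForm_hodgeStar :
    ¬ isSmoothForm_hodgeStar (k := 1) (m := 1) stdOrientation := fun H ↦
  not_isSmoothForm_hodgeStar_oneForm_imCLM _
    (H isSmoothForm_riemannianVolumeForm (by norm_num : 1 + 1 = 2) isSmoothForm_oneForm_imCLM)

/-! ### Conclusions, complex coefficients -/

/-- `x² / 2 ⊗ 1 = f₁ ⊗ 1 + f₂ ⊗ 1` lies in the `ℂ`-span of the `Δ_d`-harmonic complex forms. [folklore] -/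
theorem ofReal_zeroForm_u_mem_charmonicForms (h : 0 + 2 = 2) :
    (zeroForm u).ofReal ∈ charmonicForms stdOrientation h := by
  rw [← f₁_add_f₂, zeroForm_add, MForm.ofReal_add]
  exact add_mem
    (Submodule.subset_span ((isCHarmonicForm_ofReal_iff _ h _).2 (isHarmonicForm_zeroForm_f₁ h)))
    (Submodule.subset_span ((isCHarmonicForm_ofReal_iff _ h _).2 (isHarmonicForm_zeroForm_f₂ h)))

/-- `x² / 2 ⊗ 1` is not `Δ_d`-harmonic for the rough metric. [folklore] -/
theorem not_isCHarmonicForm_ofReal_zeroForm_u (h : 0 + 2 = 2) :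
    ¬ IsCHarmonicForm stdOrientation h (zeroForm u).ofReal := fun hu ↦
  not_isHarmonicForm_zeroForm_u h ((isCHarmonicForm_ofReal_iff _ h _).1 hu)

/-- **The rough metric on `ℂ` violates `mem_charmonicForms_iff`** (degree `0`, `n = 2`): the
complex `0`-form `x² / 2 ⊗ 1` lies in `charmonicForms` but is not `Δ_d`-harmonic. [folklore] -/
theorem not_mem_charmonicForms_iff :
    ¬ mem_charmonicForms_iff (k := 0) (m := 2) stdOrientation := fun H ↦
  not_isCHarmonicForm_ofReal_zeroForm_u _ ((H isSmoothForm_riemannianVolumeForm (by norm_num) _).1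
    (ofReal_zeroForm_u_mem_charmonicForms _))

/-- **The rough metric on `ℂ` violates `isSmoothForm_cHodgeStar`** (degree `1`, `n = 2`):
`dy ⊗ 1` is smooth but `⋆(dy ⊗ 1) = (⋆dy) ⊗ 1` is not (its real part `⋆dy = -a dx` is
differentiable nowhere). [folklore] -/
theorem not_isSmoothForm_cHodgeStar :
    ¬ isSmoothForm_cHodgeStar (k := 1) (m := 1) stdOrientation := by
  intro H
  have h1 := H isSmoothForm_riemannianVolumeForm (by norm_num : 1 + 1 = 2)
    (isSmoothForm_oneForm_imCLM.ofReal)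
  rw [MForm.cHodgeStar_ofReal] at h1
  exact not_isSmoothForm_hodgeStar_oneForm_imCLM _ (by simpa using h1.re)

end RoughMetricC

attribute [local instance] Complex.finrank_real_complex_fact
attribute [local instance 2000] RoughMetricC.roughBundle

/-- **`mem_charmonicForms_iff` cannot be discharged as stated**: its universal closure over
Riemannian bundle metrics of no regularity is false (witness: `RoughMetricC.roughBundle` on `ℂ`
with the standard orientation, `RoughMetricC.not_mem_charmonicForms_iff`). The corrected,
discharged statement is `mem_charmonicForms_iff_of_isContMDiffRiemannianBundle`
(`KaehlerHodgeCharmonicProofs.lean`). [folklore] -/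
theorem not_forall_mem_charmonicForms_iff :
    ¬ ∀ (M : Type) [TopologicalSpace M] [ChartedSpace ℂ M]
        [RiemannianBundle (fun x : M ↦ TangentSpace 𝓘(ℝ, ℂ) x)]
        (o : (x : M) → Orientation ℝ (TangentSpace 𝓘(ℝ, ℂ) x) (Fin 2)),
        mem_charmonicForms_iff (k := 0) (m := 2) o :=
  fun H ↦ RoughMetricC.not_mem_charmonicForms_iff (H ℂ RoughMetricC.stdOrientation)

/-- **`isSmoothForm_cHodgeStar` cannot be discharged as stated** either (the root cause):
`RoughMetricC.not_isSmoothForm_cHodgeStar`. Its content under the intended instances is the theorem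
`Literature.Geometry.Kaehler.IsSmoothForm.cHodgeStar`, and the corrected fact is
`isSmoothForm_cHodgeStar_of_isContMDiffRiemannianBundle` (`KaehlerHodgeSmoothProofs.lean`). [folklore] -/
theorem not_forall_isSmoothForm_cHodgeStar :
    ¬ ∀ (M : Type) [TopologicalSpace M] [ChartedSpace ℂ M]
        [RiemannianBundle (fun x : M ↦ TangentSpace 𝓘(ℝ, ℂ) x)]
        (o : (x : M) → Orientation ℝ (TangentSpace 𝓘(ℝ, ℂ) x) (Fin 2)),
        isSmoothForm_cHodgeStar (k := 1) (m := 1) o :=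
  fun H ↦ RoughMetricC.not_isSmoothForm_cHodgeStar (H ℂ RoughMetricC.stdOrientation)

/-- The real sibling facts of `RiemannianHodge.lean` fail already for manifolds modelled on the
*complex* line: `mem_harmonicForms_iff` (`RoughMetricC.not_mem_harmonicForms_iff`). [folklore] -/
theorem not_forall_mem_harmonicForms_iff_complex :
    ¬ ∀ (M : Type) [TopologicalSpace M] [ChartedSpace ℂ M]
        [RiemannianBundle (fun x : M ↦ TangentSpace 𝓘(ℝ, ℂ) x)]
        (o : (x : M) → Orientation ℝ (TangentSpace 𝓘(ℝ, ℂ) x) (Fin 2)),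
        mem_harmonicForms_iff (k := 0) (m := 2) o :=
  fun H ↦ RoughMetricC.not_mem_harmonicForms_iff (H ℂ RoughMetricC.stdOrientation)

end Literature.NumberTheory.Transcendental
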